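import Summits.CriticalPhenomena.PercolationContinuityZ3.Theorems.PercNearOneGluingNoHeavyLowerTailSahiCombTriWCorToolkit
import Summits.CriticalPhenomena.PercolationContinuityZ3.Theorems.PercNearOneGluingNoHeavyLowerTailSahiCombHarrisEq

/-!
# `Cor` of a PRINCIPAL up-set as three non-negative pieces (rearrangement + two Kleitman gaps), and its vanishing

Support file of the one-cut programme (crux `NoHeavyLowerTail`, stmt-CriticalPhenomena-4575; TRI lane of cell `prim-masterthm`; seat prim-lf-1 gen 40,
memo `FROM-prim-lf-1-gen40-CYLINDER-AND-JSWITCH.md` §3).  Continuation of `…SahiCombTriWCorNonneg` (P5 gen 24: `corP`), `…SahiCombTriWPerfectMinus`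
(`corP_eq_sum`) and `…SahiCombHarrisEq` (`Inessential`).  Toolkit for the two-generator stratum `…SahiCombTriWTwoGen`.

For `g ⊆ univ` let `↑g = upGen g = {t | g ⊆ t}` and, for a family `A`, `L_g A = loTr g A = {t | t \ g ∈ A}` (the lower `g`-trace, extended to
the whole cube; an up-set when `A` is).  For up-sets `A, B` (**`FiveUpSet.corP_upGen_eq`**):

  `Cor_{↑g}(A,B) = #(↑g ∩ (A \ L_gA) ∩ (B \ L_gB)) + [#(A∩↑g∩L_gB) − #(A∩↑g∩refl(L_gB))] + [#(L_gA∩(B∩↑g)) − #(refl(L_gA)∩(B∩↑g))]`,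

a rearrangement term plus two Kleitman gaps of up-sets of the WHOLE cube (no passage to the face cube is needed: the involution `s ↦ g ∪ sᶜ` of `↑g`
matches the two remaining terms, `sum_upGen_compl_eq`).  Hence `Cor_{↑g} ≥ 0` (`corP_upGen_nonneg`; P5's principal correlation inequality, reproved) and,
when `Cor_{↑g}(A,B) = 0`, all three pieces vanish (`pieces_of_corP_upGen_zero`) — the entry point for the Harris-equality tool.  Also:
`mem_iff_sdiff_mem_of_inessential` (stripping a set of inessential coordinates), `corP_comm`, `corP_union`, `corP_singleton_univ`.
HONEST LABEL: complete proofs, std axioms; identities and a reproof of a known stratum inequality; no new stratum in this file. [this work]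
-/

namespace Summit.CriticalPhenomena.PercolationContinuityZ3.Theorems

namespace FiveUpSet

open Finset

variable {β γ : Type} [DecidableEq β] [Fintype β] [DecidableEq γ] [Fintype γ]

/-! ### Stripping inessential coordinates -/

omit [DecidableEq β] [Fintype β] [Fintype γ] in
/-- If every coordinate of `K` is inessential for `C`, membership in `C` is unchanged by removing `K`. [this work] -/
theorem mem_iff_sdiff_mem_of_inessential {C : Finset (Finset γ)} {K : Finset γ} (hK : ∀ k ∈ K, Inessential k C) (t : Finset γ) :
    t ∈ C ↔ t \ K ∈ C := by
  induction K using Finset.induction_on generalizing t with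
  | empty => rw [sdiff_empty]
  | insert k K hk ih =>
    have hk' : Inessential k C := hK k (mem_insert_self k K)
    have hK' : ∀ k' ∈ K, Inessential k' C := fun k' h => hK k' (mem_insert_of_mem h)
    rw [ih hK' t]
    have e2 : t \ insert k K = (t \ K).erase k := by
      ext x; simp only [mem_sdiff, mem_insert, mem_erase]; tauto
    rw [e2]
    by_cases hkt : k ∈ t \ K
    · have h := hk' ((t \ K).erase k) (notMem_erase k _)
      rw [insert_erase hkt] at h
      exact h
    · rw [erase_eq_of_notMem hkt]

/-! ### Principal up-sets and the lower trace -/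

/-- The principal up-set `↑g = {t | g ⊆ t}`. [this work] -/
def upGen (g : Finset γ) : Finset (Finset γ) := univ.filter fun t => g ⊆ t

/-- The lower `g`-trace of a family, extended to the whole cube: `L_g A = {t | t \ g ∈ A}`. [this work] -/
def loTr (g : Finset γ) (A : Finset (Finset γ)) : Finset (Finset γ) := univ.filter fun t => t \ g ∈ A

omit [DecidableEq β] [Fintype β] in
/-- Membership in `↑g`. [this work] -/
@[simp] theorem mem_upGen {g t : Finset γ} : t ∈ upGen g ↔ g ⊆ t := by simp [upGen]

omit [DecidableEq β] [Fintype β] in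
/-- Membership in the lower trace. [this work] -/
@[simp] theorem mem_loTr {g : Finset γ} {A : Finset (Finset γ)} {t : Finset γ} : t ∈ loTr g A ↔ t \ g ∈ A := by simp [loTr]

omit [DecidableEq β] [Fintype β] in
/-- `↑g` is an up-set. [this work] -/
theorem isUpperSet_upGen (g : Finset γ) : IsUpperSet (upGen g : Set (Finset γ)) := by
  intro s t hst hs; rw [mem_coe, mem_upGen] at hs ⊢; exact hs.trans hst

omit [DecidableEq β] [Fintype β] in
/-- The lower trace of an up-set is an up-set. [this work] -/
theorem isUpperSet_loTr (g : Finset γ) {A : Finset (Finset γ)} (hA : IsUpperSet (A : Set (Finset γ))) : IsUpperSet (loTr g A : Set (Finset γ)) := by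
  intro s t hst hs; rw [mem_coe, mem_loTr] at hs ⊢; exact hA (sdiff_subset_sdiff hst le_rfl) hs

omit [DecidableEq β] [Fintype β] in
/-- Coordinates of `g` are inessential for the lower trace `L_g A`. [this work] -/
theorem inessential_loTr_of_mem {g : Finset γ} (A : Finset (Finset γ)) {k : γ} (hk : k ∈ g) : Inessential k (loTr g A) := by
  intro s _
  rw [mem_loTr, mem_loTr]
  have : insert k s \ g = s \ g := by
    ext x; simp only [mem_sdiff, mem_insert]
    constructor
    · rintro ⟨h1, h2⟩
      rcases h1 with rfl | h
      · exact absurd hk h2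
      · exact ⟨h, h2⟩
    · rintro ⟨h1, h2⟩; exact ⟨Or.inr h1, h2⟩
  rw [this]

/-! ### `Cor` of a principal up-set: three non-negative pieces -/

omit [DecidableEq β] [Fintype β] in
/-- Pointwise bookkeeping on `↑g`: for `s ⊇ g`,
`δ_A(s)δ_B(s) = (a₁−a₀)(b₁−b₀) + a₁(b₀ − rb₀) + b₁(a₀ − ra₀) + (ra₀·rb₀ − a₀·b₀)` with `a₁ = [s∈A]`, `a₀ = [s∖g∈A]`, `ra₀ = [sᶜ∈A]`. [this work] -/
theorem sgnDiff_mul_eq_of_subset {g : Finset γ} (A B : Finset (Finset γ)) (s : Finset γ) :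
    sgnDiff A (refl A) s * sgnDiff B (refl B) s
      = (ibit (s ∈ A) - ibit (s \ g ∈ A)) * (ibit (s ∈ B) - ibit (s \ g ∈ B))
        + ibit (s ∈ A) * (ibit (s \ g ∈ B) - ibit (sᶜ ∈ B)) + ibit (s ∈ B) * (ibit (s \ g ∈ A) - ibit (sᶜ ∈ A))
        + (ibit (sᶜ ∈ A) * ibit (sᶜ ∈ B) - ibit (s \ g ∈ A) * ibit (s \ g ∈ B)) := by
  unfold sgnDiff ibit
  simp only [mem_refl]
  ring

omit [DecidableEq β] [Fintype β] in
/-- The involution `s ↦ g ∪ sᶜ` of `↑g` exchanges `sᶜ` and `s \ g`; hence `Σ_{s⊇g} [sᶜ∈A][sᶜ∈B] = Σ_{s⊇g} [s∖g∈A][s∖g∈B]`. [this work] -/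
theorem sum_upGen_compl_eq (g : Finset γ) (A B : Finset (Finset γ)) :
    ∑ s ∈ upGen g, ibit (sᶜ ∈ A) * ibit (sᶜ ∈ B) = ∑ s ∈ upGen g, ibit (s \ g ∈ A) * ibit (s \ g ∈ B) := by
  refine Finset.sum_nbij' (fun s => g ∪ sᶜ) (fun s => g ∪ sᶜ) ?_ ?_ ?_ ?_ ?_
  · intro s _; rw [mem_upGen]; exact subset_union_left
  · intro s _; rw [mem_upGen]; exact subset_union_left
  · intro s hs; rw [mem_upGen] at hs
    ext x; have hx := @hs x; simp only [mem_union, mem_compl]; tauto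
  · intro s hs; rw [mem_upGen] at hs
    ext x; have hx := @hs x; simp only [mem_union, mem_compl]; tauto
  · intro s hs; rw [mem_upGen] at hs
    have e : (g ∪ sᶜ) \ g = sᶜ := by
      ext x; have hx := @hs x; simp only [mem_sdiff, mem_union, mem_compl]; tauto
    rw [e]

omit [DecidableEq β] [Fintype β] in
/-- **`Cor` of a principal up-set as three non-negative pieces**:
`Cor_{↑g}(A,B) = #(↑g ∩ (A∖L_gA) ∩ (B∖L_gB)) + [#(A∩↑g∩L_gB) − #(A∩↑g∩refl(L_gB))] + [#(L_gA∩(B∩↑g)) − #(refl(L_gA)∩(B∩↑g))]`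
for up-sets `A, B`. [this work] -/
theorem corP_upGen_eq (g : Finset γ) {A B : Finset (Finset γ)} (hA : IsUpperSet (A : Set (Finset γ))) (hB : IsUpperSet (B : Set (Finset γ))) :
    corP (upGen g) A B
      = ((upGen g ∩ (A \ loTr g A) ∩ (B \ loTr g B)).card : ℤ)
        + (((A ∩ upGen g ∩ loTr g B).card : ℤ) - (A ∩ upGen g ∩ refl (loTr g B)).card)
        + (((loTr g A ∩ (B ∩ upGen g)).card : ℤ) - (refl (loTr g A) ∩ (B ∩ upGen g)).card) := by
  rw [corP_eq_sum]
  rw [Finset.sum_congr rfl (fun s _ => sgnDiff_mul_eq_of_subset (g := g) A B s), sum_add_distrib, sum_add_distrib, sum_add_distrib,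
    sum_sub_distrib, sum_upGen_compl_eq, sub_self, add_zero]
  -- identify the three sums with cardinalities
  have nest : ∀ (X : Finset (Finset γ)), IsUpperSet (X : Set (Finset γ)) → ∀ s, s \ g ∈ X → s ∈ X :=
    fun X hX s h => hX sdiff_subset h
  have h1 : ∑ s ∈ upGen g, (ibit (s ∈ A) - ibit (s \ g ∈ A)) * (ibit (s ∈ B) - ibit (s \ g ∈ B))
      = ((upGen g ∩ (A \ loTr g A) ∩ (B \ loTr g B)).card : ℤ) := by
    rw [inter_assoc, ← filter_mem_eq_inter, card_filter]
    push_cast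
    refine sum_congr rfl fun s _ => ?_
    have hA' := nest A hA s; have hB' := nest B hB s
    unfold ibit
    by_cases a1 : s ∈ A <;> by_cases a0 : s \ g ∈ A <;> by_cases b1 : s ∈ B <;> by_cases b0 : s \ g ∈ B <;>
      simp [a1, a0, b1, b0, mem_inter, mem_sdiff, mem_loTr] <;> tauto
  have h2 : ∑ s ∈ upGen g, ibit (s ∈ A) * (ibit (s \ g ∈ B) - ibit (sᶜ ∈ B))
      = ((A ∩ upGen g ∩ loTr g B).card : ℤ) - (A ∩ upGen g ∩ refl (loTr g B)).card := by
    have e1 : A ∩ upGen g ∩ loTr g B = (upGen g).filter (fun s => s ∈ A ∧ s \ g ∈ B) := by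
      ext s; simp only [mem_inter, mem_filter, mem_upGen, mem_loTr]; tauto
    have e2 : A ∩ upGen g ∩ refl (loTr g B) = (upGen g).filter (fun s => s ∈ A ∧ sᶜ ∈ B) := by
      ext s; simp only [mem_inter, mem_filter, mem_upGen, mem_refl, mem_loTr]
      constructor
      · rintro ⟨⟨ha, hg⟩, hb⟩
        have : sᶜ \ g = sᶜ := by
          ext x; simp only [mem_sdiff, mem_compl]; exact ⟨fun h => h.1, fun h => ⟨h, fun hx => h (hg hx)⟩⟩
        rw [this] at hb; exact ⟨hg, ha, hb⟩
      · rintro ⟨hg, ha, hb⟩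
        have : sᶜ \ g = sᶜ := by
          ext x; simp only [mem_sdiff, mem_compl]; exact ⟨fun h => h.1, fun h => ⟨h, fun hx => h (hg hx)⟩⟩
        refine ⟨⟨ha, hg⟩, ?_⟩; rw [this]; exact hb
    rw [e1, e2, card_filter, card_filter]
    push_cast
    rw [← sum_sub_distrib]
    refine sum_congr rfl fun s _ => ?_
    unfold ibit
    by_cases a1 : s ∈ A <;> by_cases b0 : s \ g ∈ B <;> by_cases rb : sᶜ ∈ B <;> simp [a1, b0, rb]
  have h3 : ∑ s ∈ upGen g, ibit (s ∈ B) * (ibit (s \ g ∈ A) - ibit (sᶜ ∈ A))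
      = ((loTr g A ∩ (B ∩ upGen g)).card : ℤ) - (refl (loTr g A) ∩ (B ∩ upGen g)).card := by
    have e1 : loTr g A ∩ (B ∩ upGen g) = (upGen g).filter (fun s => s ∈ B ∧ s \ g ∈ A) := by
      ext s; simp only [mem_inter, mem_filter, mem_upGen, mem_loTr]; tauto
    have e2 : refl (loTr g A) ∩ (B ∩ upGen g) = (upGen g).filter (fun s => s ∈ B ∧ sᶜ ∈ A) := by
      ext s; simp only [mem_inter, mem_filter, mem_upGen, mem_refl, mem_loTr]
      constructor
      · rintro ⟨ha, hb, hg⟩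
        have : sᶜ \ g = sᶜ := by
          ext x; simp only [mem_sdiff, mem_compl]; exact ⟨fun h => h.1, fun h => ⟨h, fun hx => h (hg hx)⟩⟩
        rw [this] at ha; exact ⟨hg, hb, ha⟩
      · rintro ⟨hg, hb, ha⟩
        have : sᶜ \ g = sᶜ := by
          ext x; simp only [mem_sdiff, mem_compl]; exact ⟨fun h => h.1, fun h => ⟨h, fun hx => h (hg hx)⟩⟩
        refine ⟨?_, hb, hg⟩; rw [this]; exact ha
    rw [e1, e2, card_filter, card_filter]
    push_cast
    rw [← sum_sub_distrib]
    refine sum_congr rfl fun s _ => ?_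
    unfold ibit
    by_cases b1 : s ∈ B <;> by_cases a0 : s \ g ∈ A <;> by_cases ra : sᶜ ∈ A <;> simp [b1, a0, ra]
  rw [h1, h2, h3]

omit [DecidableEq β] [Fintype β] in
/-- **`Cor_{↑g}(A,B) ≥ 0`** for up-sets (the principal stratum's correlation inequality, here from the three-piece decomposition). [this work] -/
theorem corP_upGen_nonneg (g : Finset γ) {A B : Finset (Finset γ)} (hA : IsUpperSet (A : Set (Finset γ))) (hB : IsUpperSet (B : Set (Finset γ))) :
    0 ≤ corP (upGen g) A B := by
  rw [corP_upGen_eq g hA hB]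
  have hAg : IsUpperSet ((A ∩ upGen g : Finset (Finset γ)) : Set (Finset γ)) := by rw [coe_inter]; exact hA.inter (isUpperSet_upGen g)
  have hBg : IsUpperSet ((B ∩ upGen g : Finset (Finset γ)) : Set (Finset γ)) := by rw [coe_inter]; exact hB.inter (isUpperSet_upGen g)
  have k1 := card_inter_refl_le hAg (isUpperSet_loTr g hB)
  have k2 := card_refl_inter_le hBg (isUpperSet_loTr g hA)
  have k1' : ((A ∩ upGen g ∩ refl (loTr g B)).card : ℤ) ≤ (A ∩ upGen g ∩ loTr g B).card := by exact_mod_cast k1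
  have k2' : ((refl (loTr g A) ∩ (B ∩ upGen g)).card : ℤ) ≤ (loTr g A ∩ (B ∩ upGen g)).card := by exact_mod_cast k2
  have k0 : (0 : ℤ) ≤ (upGen g ∩ (A \ loTr g A) ∩ (B \ loTr g B)).card := by exact_mod_cast Nat.zero_le _
  linarith

omit [DecidableEq β] [Fintype β] in
/-- If `Cor_{↑g}(A,B) = 0` then all three pieces vanish: no `s ⊇ g` with `s ∈ A∖L_gA` and `s ∈ B∖L_gB`, and the two Kleitman gaps are zero. [this work] -/
theorem pieces_of_corP_upGen_zero (g : Finset γ) {A B : Finset (Finset γ)} (hA : IsUpperSet (A : Set (Finset γ))) (hB : IsUpperSet (B : Set (Finset γ)))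
    (h0 : corP (upGen g) A B = 0) :
    (∀ s : Finset γ, g ⊆ s → s ∈ A → s ∈ B → (s \ g ∈ A ∨ s \ g ∈ B))
      ∧ (A ∩ upGen g ∩ refl (loTr g B)).card = (A ∩ upGen g ∩ loTr g B).card
      ∧ (refl (loTr g A) ∩ (B ∩ upGen g)).card = (loTr g A ∩ (B ∩ upGen g)).card := by
  rw [corP_upGen_eq g hA hB] at h0
  have hAg : IsUpperSet ((A ∩ upGen g : Finset (Finset γ)) : Set (Finset γ)) := by rw [coe_inter]; exact hA.inter (isUpperSet_upGen g)
  have hBg : IsUpperSet ((B ∩ upGen g : Finset (Finset γ)) : Set (Finset γ)) := by rw [coe_inter]; exact hB.inter (isUpperSet_upGen g)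
  have k1 := card_inter_refl_le hAg (isUpperSet_loTr g hB)
  have k2 := card_refl_inter_le hBg (isUpperSet_loTr g hA)
  have k1' : ((A ∩ upGen g ∩ refl (loTr g B)).card : ℤ) ≤ (A ∩ upGen g ∩ loTr g B).card := by exact_mod_cast k1
  have k2' : ((refl (loTr g A) ∩ (B ∩ upGen g)).card : ℤ) ≤ (loTr g A ∩ (B ∩ upGen g)).card := by exact_mod_cast k2
  have k0 : (0 : ℤ) ≤ (upGen g ∩ (A \ loTr g A) ∩ (B \ loTr g B)).card := by exact_mod_cast Nat.zero_le _
  have hR : ((upGen g ∩ (A \ loTr g A) ∩ (B \ loTr g B)).card : ℤ) = 0 := by linarith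
  refine ⟨?_, ?_, ?_⟩
  · intro s hg hsA hsB
    by_contra hnot
    push Not at hnot
    have hmem : s ∈ upGen g ∩ (A \ loTr g A) ∩ (B \ loTr g B) := by
      simp only [mem_inter, mem_sdiff, mem_upGen, mem_loTr]
      exact ⟨⟨hg, hsA, hnot.1⟩, hsB, hnot.2⟩
    have : 0 < (upGen g ∩ (A \ loTr g A) ∩ (B \ loTr g B)).card := card_pos.2 ⟨s, hmem⟩
    omega
  · have : ((A ∩ upGen g ∩ refl (loTr g B)).card : ℤ) = (A ∩ upGen g ∩ loTr g B).card := by linarith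
    exact_mod_cast this
  · have : ((refl (loTr g A) ∩ (B ∩ upGen g)).card : ℤ) = (loTr g A ∩ (B ∩ upGen g)).card := by linarith
    exact_mod_cast this

end FiveUpSet

end Summit.CriticalPhenomena.PercolationContinuityZ3.Theorems
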